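import Summits.QuantumFields.YangMills.Theorems.BalabanUVNodesSpineReadingOfRecord13CoPHKComponentSizeBlocksFresh

/-!
# THE N20 PRODUCT SOCKET MOVED TO THE FRESH EVENTS: for a ϱ-separated skeleton family `B` of level-`lv j` blocks the INSIDE event «every block of `B` lies in `Z_j`» is covered by
# the ASSIGNMENTS of a fresh cause to each block (NODE 00 `exists_fresh_of_iterBlock_subset_Λ_compl`, block by block), so gen 34's product letter «weight{B ⊆ Z_j} ≤ η^{|B|}·total»
# follows from JOINT-FRESH PRODUCT letters — one factor `ζ K j i_b` per block at the creation level of its fresh cause, against the TOTAL weight, NO conditioning — by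
# `Π_{b∈B} Σ_{(i,c)} ζ = Σ_{assignments} Π_b ζ` (`Finset.prod_sum`) and the inheritance volume `Σ_{i∈[1,j]} (L^4)^{lv j − lv i}·ζ K j i ≤ η K j`

Cell `pub-ymgap`, YM-PLAN Track A (HUMAN RULING D-0062; width push D-0149); seat `pub-ymgap-dag-n20-d` (R134 (a) N20 NE7b s3 = the U5d ∕ `crOfRecord₁₃` lineage, its declarer)
gen 35; companion of `…CoPHKComponentSizeBlocksFresh` (gen 35: `sum_filter_le_sum_sum_filter_of_cover`, `card_filter_iterBlock_subset_four`), `…CoPHKComponentSizeBlocksSeqIndex`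
(gen 34 v1.1: ★★★ `relWeightBound_card_of_sepInsideSeqLetters_id_supNear`, hypotheses `hEA ∕ hEB`), `Node00/TwoRunSiteFreshCubes` (gen 35: `exists_fresh_of_iterBlock_subset_Λ_compl`,
`hdvd_of_lv_le`) and `Node00/TwoRunSiteSkeletons` (gen 34: `card_eq_of_mem_sepAnimalCoverFamily`).  `--kind proof --supports stmt-QuantumFields-27366 --as helper` (K3⁸);
COUNT-NEUTRAL; THEOREMS ONLY (0 `def`).  [III] = [Balaban1988Convergent]; [LF-II] = [Balaban1989LargeFieldII].
WHY.  Of the socket shapes of record the PRODUCT one (gen 34 v1.1 on the sequence index: «for every member `(y₀, B)` of the ϱ-separated skeleton cover family, the classes whose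
`Z_j` contains all blocks of `B` weigh at most `η K j ^ k K j` times the total») is the closest to print: [LF-II] (1.79) p. 383 is a PRODUCT over the components of the large-field
region of one factor per component, (1.85) p. 386 ∕ (1.89) p. 387 the per-NEW-region smallness.  The companion file moved the one-block CONDITIONAL letter to the fresh events; this
file moves the PRODUCT letter: the inside event for `B` is covered by the assignments `a : b ↦ (i_b, c_b)` of a level `i_b ≤ j` and a level-`lv K i_b` block `c_b ⊆` the block of
`b`, FRESH at `i_b` (`c_b ⊆ Z_{i_b}`, `c_b ⊆ Λ_{i_b−1}` when `i_b ≥ 2`) — ★★ `sum_insideFamily_le_sum_jointFresh_A ∕ _B`; a JOINT-FRESH PRODUCT letter «weight{every `c_b` fresh at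
`i_b`} ≤ (Π_b ζ K j i_b) · total» then sums, over all assignments, to `Π_{b ∈ B} (Σ_{i ≤ j} (L^4)^{lv j − lv i} ζ K j i) · total ≤ (η K j)^{|B|} · total` (★ `sum_pi_prod_eq_prod_volume`),
and gen 34's face follows verbatim: ★★★ `relWeightBound_card_of_jointFreshSeqLetters_id_supNear`.  The supplier's statement has NO environment and NO conditioning: separated
fresh blocks at their own creation levels pay multiplicatively against the run's total (2.18) weight — the shape of (1.79) × (1.85), up to the one unprinted step (relative to the
TOTAL, i.e. the term-to-partition-function normalisation, `T4WeightBudgetKP` R3b).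
HONEST FRAMING.  [folklore] finite-sum bookkeeping BY NAME; the joint-fresh letters are HYPOTHESES (inhabited for no family today; NOT PRINTED as statements about the (2.18) class
weights; inhabitable only under a history-rewriting residual selector, (ρ1)∕(ρ2) of `…SpineReadingOfRecord13CoPH` — levels the record no longer carries contribute empty events,
`ζ = 0`); NO weight is bounded, NO estimate proved; nothing of Bałaban's asserted; NE7 ∕ NE7b ∕ NE7c NOT PRINTED for `d = 4` ∕ NOT proved; no `Provisos₁₃CoPH` inhabitant claimed
(K0⁷ OPEN); K3⁸ v7 untouched; N19 ∕ N20 ∕ N21 ∕ N27 NOT discharged; counts UNMOVED (typed 28∕28 · discharged 8∕27); one finite four-torus programme at fixed `ε` — NOT ℝ⁴, NOT OS, NOT a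
mass gap, NOT the Clay problem.  No `def`, no `instance`, no `notation`, no `sorry`; no decl below carries a cite tag.
-/

noncomputable section

open scoped BigOperators
open Finset

namespace YMDAG.UVSplit

open Literature.MathematicalPhysics.QuantumFieldTheory.Balaban1983to89
open Literature.MathematicalPhysics.QuantumFieldTheory.Balaban1983to89.T4Continuum
open Literature.MathematicalPhysics.QuantumFieldTheory.Balaban1983to89.Node00
open Literature.MathematicalPhysics.QuantumFieldTheory.Balaban1983to89.B5Eq118OneStroke (iterBlockOf iterBlock)
open T4WeightBudget (RelWeightBound)
open Summit.QuantumFields.YangMills.BalabanUVNodes.N21KeyedShellWeightShellZero (wOfRecord₉_nonneg_of_provisos₁₃CoPH)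
open Summit.QuantumFields.YangMills.Theorems.N21ShellSplitOfRecord13CoPH (classWeightOfDatum₉_nonneg')

variable {F : T4Family} {N : ℕ} [NeZero N]

/-! ## §1 The inside event of a block family is covered by the assignments of fresh causes -/

section Cover

variable (θ : Stage13HParams F N) (hP : θ.Provisos₁₃CoPH F N) (K₀ : ℕ) (g₀ : ℕ → ℝ) (os : List (ULoop F)) (lv : ℕ → ℕ → ℕ)

open scoped Classical in
/-- ★★ **RUN A — THE INSIDE EVENT OF A BLOCK FAMILY IS COVERED BY THE ASSIGNMENTS OF FRESH CAUSES**: for `1 ≤ j`, block levels `lv K` monotone on `[1, j]` with `lv K i ≤ i` and in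
the standing range, and any finite family `B` of level-`lv K j` blocks: the (2.18) class weights of run A's sequences of record whose `Z_j` contains every block of `B` sum to at most
the sum, over the assignments `a ∈ B.pi T` (`T b` = the pairs `⟨i, c⟩`, `i ∈ [1, j]`, `c` a level-`lv K i` block inside `b`'s block), of the weights of the JOINT-FRESH events
«for every `b ∈ B`: `c_b ⊆ Z_{i_b}(s)` and (`i_b ≥ 2 →`) `c_b ⊆ Λ_{i_b−1}(s)`» (one fresh cause chosen per block by NODE 00 `exists_fresh_of_iterBlock_subset_Λ_compl`). [bookkeeping] -/
theorem sum_insideFamily_le_sum_jointFresh_A (K : ℕ) (t : ℝ) {j : ℕ} (h1 : 1 ≤ j)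
    (hmono : ∀ i i', 1 ≤ i → i ≤ i' → i' ≤ j → lv K i ≤ lv K i') (hlv : ∀ i, lv K i ≤ F.m + (K₀ + K)) (hlvle : ∀ i, 1 ≤ i → i ≤ j → lv K i ≤ i)
    (B : Finset (Site (F.P (K₀ + K)) (lv K j))) :
    ∑ s ∈ Finset.univ.filter (fun s : SeqOfRecord F θ.ν θ.τ9.M (histA₁₃ θ K₀ g₀ K) (K₀ + K) (K₀ + K) =>
        ∀ b ∈ B, (↑(iterBlock (lv K j) b) : Set (Site (F.P (K₀ + K)) 0)) ⊆ (s.Λ j)ᶜ),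
      classWeightOfDatum₉ F N θ.toStage9Params (datumOfRecord₁₃CoPH F N θ hP) g₀ os (runA₁₃ F K₀ g₀ K) (histA₁₃ θ K₀ g₀ K) (K₀ + K) t s ≤
    ∑ a ∈ B.pi (fun b => (Finset.Icc 1 j).sigma fun i => Finset.univ.filter (fun c : Site (F.P (K₀ + K)) (lv K i) =>
        (↑(iterBlock (lv K i) c) : Set (Site (F.P (K₀ + K)) 0)) ⊆ ↑(iterBlock (lv K j) b))),
      ∑ s ∈ Finset.univ.filter (fun s : SeqOfRecord F θ.ν θ.τ9.M (histA₁₃ θ K₀ g₀ K) (K₀ + K) (K₀ + K) =>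
          ∀ x ∈ B.attach, (↑(iterBlock (lv K (a x.1 x.2).1) (a x.1 x.2).2) : Set (Site (F.P (K₀ + K)) 0)) ⊆ (s.Λ (a x.1 x.2).1)ᶜ ∧
            (2 ≤ (a x.1 x.2).1 → (↑(iterBlock (lv K (a x.1 x.2).1) (a x.1 x.2).2) : Set (Site (F.P (K₀ + K)) 0)) ⊆ s.Λ ((a x.1 x.2).1 - 1))),
        classWeightOfDatum₉ F N θ.toStage9Params (datumOfRecord₁₃CoPH F N θ hP) g₀ os (runA₁₃ F K₀ g₀ K) (histA₁₃ θ K₀ g₀ K) (K₀ + K) t s := by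
  refine sum_filter_le_sum_sum_filter_of_cover _ _ (fun s => classWeightOfDatum₉_nonneg' F N θ.toStage9Params (datumOfRecord₁₃CoPH F N θ hP) g₀ os
    (runA₁₃ F K₀ g₀ K) (histA₁₃ θ K₀ g₀ K) (K₀ + K) (wOfRecord₉_nonneg_of_provisos₁₃CoPH F θ hP (runA₁₃ F K₀ g₀ K) (histA₁₃ θ K₀ g₀ K)) t s) _ _ ?_
  intro s hs
  -- one fresh cause per block of the family
  have hex : ∀ b ∈ B, ∃ q : (Σ i : ℕ, Site (F.P (K₀ + K)) (lv K i)),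
      q ∈ ((Finset.Icc 1 j).sigma fun i => Finset.univ.filter (fun c : Site (F.P (K₀ + K)) (lv K i) =>
        (↑(iterBlock (lv K i) c) : Set (Site (F.P (K₀ + K)) 0)) ⊆ ↑(iterBlock (lv K j) b))) ∧
      ((↑(iterBlock (lv K q.1) q.2) : Set (Site (F.P (K₀ + K)) 0)) ⊆ (s.Λ q.1)ᶜ ∧
        (2 ≤ q.1 → (↑(iterBlock (lv K q.1) q.2) : Set (Site (F.P (K₀ + K)) 0)) ⊆ s.Λ (q.1 - 1))) := by
    intro b hb
    obtain ⟨i, hi, c, hcb, hcZ, hfresh⟩ := exists_fresh_of_iterBlock_subset_Λ_compl F θ.ν θ.τ9.M (histA₁₃ θ K₀ g₀ K) (K₀ + K) (K₀ + K) s (lv K)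
      hmono hlv (hdvd_of_lv_le F θ.ν θ.τ9.M (histA₁₃ θ K₀ g₀ K) (lv K) hlvle) h1 (hs b hb)
    exact ⟨⟨i, c⟩, Finset.mem_sigma.2 ⟨hi, Finset.mem_filter.2 ⟨Finset.mem_univ _, hcb⟩⟩, hcZ, hfresh⟩
  choose f hfT hfresh using hex
  exact ⟨f, Finset.mem_pi.2 hfT, fun x _ => hfresh x.1 x.2⟩

open scoped Classical in
/-- ★★ **RUN B — THE INSIDE EVENT OF A BLOCK FAMILY IS COVERED BY THE ASSIGNMENTS OF FRESH CAUSES** (`0 < M`): the same over run B's sequences `s′` with the regions of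
`truncShift … s′`. [bookkeeping] -/
theorem sum_insideFamily_le_sum_jointFresh_B (hM : 0 < θ.τ9.M) (K : ℕ) (t : ℝ) {j : ℕ} (h1 : 1 ≤ j)
    (hmono : ∀ i i', 1 ≤ i → i ≤ i' → i' ≤ j → lv K i ≤ lv K i') (hlv : ∀ i, lv K i ≤ F.m + (K₀ + K)) (hlvle : ∀ i, 1 ≤ i → i ≤ j → lv K i ≤ i)
    (B : Finset (Site (F.P (K₀ + K)) (lv K j))) :
    ∑ s' ∈ Finset.univ.filter (fun s' : SeqOfRecord F θ.ν θ.τ9.M (histB₁₃ θ K₀ g₀ K) (K₀ + K + 1) (K₀ + K + 1) =>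
        ∀ b ∈ B, (↑(iterBlock (lv K j) b) : Set (Site (F.P (K₀ + K)) 0)) ⊆ ((truncShift F θ.ν hM (histB₁₃ θ K₀ g₀ K) s').Λ j)ᶜ),
      classWeightOfDatum₉ F N θ.toStage9Params (datumOfRecord₁₃CoPH F N θ hP) g₀ os (runB₁₃ F K₀ g₀ K) (histB₁₃ θ K₀ g₀ K) (K₀ + K + 1) t s' ≤
    ∑ a ∈ B.pi (fun b => (Finset.Icc 1 j).sigma fun i => Finset.univ.filter (fun c : Site (F.P (K₀ + K)) (lv K i) =>
        (↑(iterBlock (lv K i) c) : Set (Site (F.P (K₀ + K)) 0)) ⊆ ↑(iterBlock (lv K j) b))),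
      ∑ s' ∈ Finset.univ.filter (fun s' : SeqOfRecord F θ.ν θ.τ9.M (histB₁₃ θ K₀ g₀ K) (K₀ + K + 1) (K₀ + K + 1) =>
          ∀ x ∈ B.attach, (↑(iterBlock (lv K (a x.1 x.2).1) (a x.1 x.2).2) : Set (Site (F.P (K₀ + K)) 0)) ⊆
              ((truncShift F θ.ν hM (histB₁₃ θ K₀ g₀ K) s').Λ (a x.1 x.2).1)ᶜ ∧
            (2 ≤ (a x.1 x.2).1 → (↑(iterBlock (lv K (a x.1 x.2).1) (a x.1 x.2).2) : Set (Site (F.P (K₀ + K)) 0)) ⊆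
              (truncShift F θ.ν hM (histB₁₃ θ K₀ g₀ K) s').Λ ((a x.1 x.2).1 - 1))),
        classWeightOfDatum₉ F N θ.toStage9Params (datumOfRecord₁₃CoPH F N θ hP) g₀ os (runB₁₃ F K₀ g₀ K) (histB₁₃ θ K₀ g₀ K) (K₀ + K + 1) t s' := by
  refine sum_filter_le_sum_sum_filter_of_cover _ _ (fun s' => classWeightOfDatum₉_nonneg' F N θ.toStage9Params (datumOfRecord₁₃CoPH F N θ hP) g₀ os
    (runB₁₃ F K₀ g₀ K) (histB₁₃ θ K₀ g₀ K) (K₀ + K + 1) (wOfRecord₉_nonneg_of_provisos₁₃CoPH F θ hP (runB₁₃ F K₀ g₀ K) (histB₁₃ θ K₀ g₀ K)) t s') _ _ ?_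
  intro s' hs
  have hex : ∀ b ∈ B, ∃ q : (Σ i : ℕ, Site (F.P (K₀ + K)) (lv K i)),
      q ∈ ((Finset.Icc 1 j).sigma fun i => Finset.univ.filter (fun c : Site (F.P (K₀ + K)) (lv K i) =>
        (↑(iterBlock (lv K i) c) : Set (Site (F.P (K₀ + K)) 0)) ⊆ ↑(iterBlock (lv K j) b))) ∧
      ((↑(iterBlock (lv K q.1) q.2) : Set (Site (F.P (K₀ + K)) 0)) ⊆ ((truncShift F θ.ν hM (histB₁₃ θ K₀ g₀ K) s').Λ q.1)ᶜ ∧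
        (2 ≤ q.1 → (↑(iterBlock (lv K q.1) q.2) : Set (Site (F.P (K₀ + K)) 0)) ⊆ (truncShift F θ.ν hM (histB₁₃ θ K₀ g₀ K) s').Λ (q.1 - 1))) := by
    intro b hb
    obtain ⟨i, hi, c, hcb, hcZ, hfresh⟩ := exists_fresh_of_iterBlock_subset_Λ_compl F θ.ν θ.τ9.M (fun j => histB₁₃ θ K₀ g₀ K (j + 1)) (K₀ + K) (K₀ + K)
      (truncShift F θ.ν hM (histB₁₃ θ K₀ g₀ K) s') (lv K) hmono hlv (hdvd_of_lv_le F θ.ν θ.τ9.M (fun j => histB₁₃ θ K₀ g₀ K (j + 1)) (lv K) hlvle) h1 (hs b hb)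
    exact ⟨⟨i, c⟩, Finset.mem_sigma.2 ⟨hi, Finset.mem_filter.2 ⟨Finset.mem_univ _, hcb⟩⟩, hcZ, hfresh⟩
  choose f hfT hfresh using hex
  exact ⟨f, Finset.mem_pi.2 hfT, fun x _ => hfresh x.1 x.2⟩

end Cover

/-! ## §2 The assignment sum of the product of factors is the product of the volume sums -/

section Arithmetic

variable (K₀ : ℕ) (lv : ℕ → ℕ → ℕ)

open scoped Classical in
/-- ★ **`Σ_{assignments} Π_b ζ K j i_b = Π_{b ∈ B} Σ_{i ∈ [1,j]} (L^4)^{lv K j − lv K i} · ζ K j i`** (`Finset.prod_sum` backwards, then the sigma sum and the block count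
`card_filter_iterBlock_subset_four` per level; block levels `lv K` monotone on `[1, j]`, in the standing range). [bookkeeping] -/
theorem sum_pi_prod_eq_prod_volume (K : ℕ) {j : ℕ} (hmono : ∀ i i', 1 ≤ i → i ≤ i' → i' ≤ j → lv K i ≤ lv K i') (hlvj : lv K j ≤ F.m + (K₀ + K)) (ζ : ℕ → ℕ → ℕ → ℝ)
    (B : Finset (Site (F.P (K₀ + K)) (lv K j))) :
    ∑ a ∈ B.pi (fun b => (Finset.Icc 1 j).sigma fun i => Finset.univ.filter (fun c : Site (F.P (K₀ + K)) (lv K i) =>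
        (↑(iterBlock (lv K i) c) : Set (Site (F.P (K₀ + K)) 0)) ⊆ ↑(iterBlock (lv K j) b))),
      ∏ x ∈ B.attach, ζ K j (a x.1 x.2).1 =
    ∏ _b ∈ B, ∑ i ∈ Finset.Icc 1 j, ((F.L ^ 4) ^ (lv K j - lv K i) : ℝ) * ζ K j i := by
  refine ((Finset.prod_sum B (fun b => (Finset.Icc 1 j).sigma fun i => Finset.univ.filter (fun c : Site (F.P (K₀ + K)) (lv K i) =>
        (↑(iterBlock (lv K i) c) : Set (Site (F.P (K₀ + K)) 0)) ⊆ ↑(iterBlock (lv K j) b))) (fun _ q => ζ K j q.1)).symm).trans ?_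
  refine Finset.prod_congr rfl fun b _ => ?_
  rw [Finset.sum_sigma]
  refine Finset.sum_congr rfl fun i hi => ?_
  obtain ⟨hi1, hij⟩ := Finset.mem_Icc.1 hi
  have hc := card_filter_iterBlock_subset_four K₀ lv K (hmono i j hi1 hij le_rfl) hlvj b
  simp only [Finset.sum_const, hc]
  ring

/-- **THE PRODUCT OF THE VOLUME SUMS IS AT MOST `η K j ^ |B|`** when `0 ≤ ζ` and `Σ_{i ∈ [1,j]} (L^4)^{lv K j − lv K i} · ζ K j i ≤ η K j`. [bookkeeping] -/
theorem prod_volume_le_pow {K j : ℕ} {ζ : ℕ → ℕ → ℕ → ℝ} {η : ℕ → ℕ → ℝ} (hζ0 : ∀ i, 0 ≤ ζ K j i)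
    (hζη : ∑ i ∈ Finset.Icc 1 j, ((F.L ^ 4) ^ (lv K j - lv K i) : ℝ) * ζ K j i ≤ η K j) (B : Finset (Site (F.P (K₀ + K)) (lv K j))) :
    ∏ _b ∈ B, ∑ i ∈ Finset.Icc 1 j, ((F.L ^ 4) ^ (lv K j - lv K i) : ℝ) * ζ K j i ≤ η K j ^ B.card := by
  rw [Finset.prod_const]
  exact pow_le_pow_left₀ (Finset.sum_nonneg fun i _ => mul_nonneg (by positivity) (hζ0 i)) hζη _

end Arithmetic

/-! ## §3 The face from joint-fresh PRODUCT letters on the sequence index -/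

section Face

variable (θ : Stage13HParams F N) (hP : θ.Provisos₁₃CoPH F N) (K₀ : ℕ) (g₀ : ℕ → ℝ) (os : List (ULoop F)) (jcut : ℕ → ℕ) (ϱ k lv : ℕ → ℕ → ℕ)

open scoped Classical in
/-- ★★★ **THE N20 FACE AT THE RECORD's CARRIERS FROM JOINT-FRESH PRODUCT LETTERS ON THE SEQUENCE INDEX OF RECORD** (`0 < M`; block levels `lv K` monotone on `[1, jcut K]` with
`lv K j ≤ j`; metric separation `SupNear (ϱ K j)`; schedule `k K j ≥ ⌈log₂ |Site_{lv K j}|⌉ + K + j + 3`; gen 34's numerics `0 ≤ η K j ≤ η₀ ≤ 1`, `2·((2ϱ+1)^4·81·(2ϱ+1)^4)²·η K j ≤ 1`;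
`0 ≤ ζ` and the INHERITANCE VOLUME `Σ_{i ∈ [1,j]} (L^4)^{lv K j − lv K i} · ζ K j i ≤ η K j`).  Run A's letter: for every step `K`, source `|t| ≤ 1`, level `j ∈ [1, jcut K]`, member
`(y₀, B)` of `sepAnimalCoverFamily SiteTouch (SupNear (ϱ K j)) (k K j)` (a `ϱ K j`-separated skeleton-connected `k K j`-set of level-`lv K j` blocks) and assignment `a` of a pair
`(i_b, c_b)` to each `b ∈ B` (`i_b ∈ [1, j]`, `c_b` a level-`lv K i_b` block inside `b`'s block), the (2.18) class weights of run A's sequences of record with «for every `b ∈ B`: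
`c_b ⊆ Z_{i_b}(s)` and (`i_b ≥ 2 →`) `c_b ⊆ Λ_{i_b−1}(s)`» sum to at most `(Π_{b ∈ B} ζ K j i_b)` times the sum of ALL of run A's class weights — NO environment, NO conditioning;
run B likewise over its sequences `s′` with the regions of `truncShift … s′`.  Conclusion: gen 34's face verbatim — `RelWeightBound` at
`crOfRecord₁₃K (keyReadingId₁₃ …) (badKeyReadingOfBigComponent₁₃ … (bigDialOfCard₁₃ K₀ ((2ϱ+1)^4·k·L^{4lv}))) …`'s carriers with `W K := η₀ · 2^{−(K+1)}`
(via `…SeqIndex.relWeightBound_card_of_sepInsideSeqLetters_id_supNear`, §1's cover, §2's arithmetic and `|B| = k K j`). [bookkeeping] -/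
theorem relWeightBound_card_of_jointFreshSeqLetters_id_supNear (hM : 0 < θ.τ9.M)
    {η : ℕ → ℕ → ℝ} {η₀ : ℝ} (hη0 : ∀ K j, 0 ≤ η K j) (hη1 : ∀ K j, η K j ≤ η₀) (hη₀ : η₀ ≤ 1)
    (hD : ∀ K j, 2 * ((((2 * ϱ K j + 1) ^ 4 : ℕ) : ℝ) * 3 ^ 4 * ((2 * ϱ K j + 1) ^ 4 : ℕ)) ^ 2 * η K j ≤ 1)
    (hks : ∀ K j, Nat.clog 2 (Fintype.card (Site (F.P (K₀ + K)) (lv K j))) + K + j + 3 ≤ k K j) (hlv : ∀ K j, lv K j ≤ F.m + (K₀ + K))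
    (hlvj : ∀ K, ∀ j ∈ Finset.Icc 1 (jcut K), lv K j ≤ j) (hmono : ∀ K i i', 1 ≤ i → i ≤ i' → i' ≤ jcut K → lv K i ≤ lv K i')
    {ζ : ℕ → ℕ → ℕ → ℝ} (hζ0 : ∀ K j i, 0 ≤ ζ K j i)
    (hζη : ∀ K, ∀ j ∈ Finset.Icc 1 (jcut K), ∑ i ∈ Finset.Icc 1 j, ((F.L ^ 4) ^ (lv K j - lv K i) : ℝ) * ζ K j i ≤ η K j)
    (hPA : ∀ (K : ℕ) (t : ℝ), |t| ≤ 1 → ∀ j ∈ Finset.Icc 1 (jcut K),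
      ∀ p ∈ sepAnimalCoverFamily (SiteTouch (P := F.P (K₀ + K)) (j := lv K j)) (SupNear (P := F.P (K₀ + K)) (j := lv K j) (ϱ K j)) (k K j),
      ∀ a ∈ p.2.pi (fun b => (Finset.Icc 1 j).sigma fun i => Finset.univ.filter (fun c : Site (F.P (K₀ + K)) (lv K i) =>
        (↑(iterBlock (lv K i) c) : Set (Site (F.P (K₀ + K)) 0)) ⊆ ↑(iterBlock (lv K j) b))),
      ∑ s ∈ Finset.univ.filter (fun s : SeqOfRecord F θ.ν θ.τ9.M (histA₁₃ θ K₀ g₀ K) (K₀ + K) (K₀ + K) =>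
          ∀ x ∈ p.2.attach, (↑(iterBlock (lv K (a x.1 x.2).1) (a x.1 x.2).2) : Set (Site (F.P (K₀ + K)) 0)) ⊆ (s.Λ (a x.1 x.2).1)ᶜ ∧
            (2 ≤ (a x.1 x.2).1 → (↑(iterBlock (lv K (a x.1 x.2).1) (a x.1 x.2).2) : Set (Site (F.P (K₀ + K)) 0)) ⊆ s.Λ ((a x.1 x.2).1 - 1))),
        classWeightOfDatum₉ F N θ.toStage9Params (datumOfRecord₁₃CoPH F N θ hP) g₀ os (runA₁₃ F K₀ g₀ K) (histA₁₃ θ K₀ g₀ K) (K₀ + K) t s ≤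
      (∏ x ∈ p.2.attach, ζ K j (a x.1 x.2).1) * ∑ s : SeqOfRecord F θ.ν θ.τ9.M (histA₁₃ θ K₀ g₀ K) (K₀ + K) (K₀ + K),
        classWeightOfDatum₉ F N θ.toStage9Params (datumOfRecord₁₃CoPH F N θ hP) g₀ os (runA₁₃ F K₀ g₀ K) (histA₁₃ θ K₀ g₀ K) (K₀ + K) t s)
    (hPB : ∀ (K : ℕ) (t : ℝ), |t| ≤ 1 → ∀ j ∈ Finset.Icc 1 (jcut K),
      ∀ p ∈ sepAnimalCoverFamily (SiteTouch (P := F.P (K₀ + K)) (j := lv K j)) (SupNear (P := F.P (K₀ + K)) (j := lv K j) (ϱ K j)) (k K j),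
      ∀ a ∈ p.2.pi (fun b => (Finset.Icc 1 j).sigma fun i => Finset.univ.filter (fun c : Site (F.P (K₀ + K)) (lv K i) =>
        (↑(iterBlock (lv K i) c) : Set (Site (F.P (K₀ + K)) 0)) ⊆ ↑(iterBlock (lv K j) b))),
      ∑ s' ∈ Finset.univ.filter (fun s' : SeqOfRecord F θ.ν θ.τ9.M (histB₁₃ θ K₀ g₀ K) (K₀ + K + 1) (K₀ + K + 1) =>
          ∀ x ∈ p.2.attach, (↑(iterBlock (lv K (a x.1 x.2).1) (a x.1 x.2).2) : Set (Site (F.P (K₀ + K)) 0)) ⊆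
              ((truncShift F θ.ν hM (histB₁₃ θ K₀ g₀ K) s').Λ (a x.1 x.2).1)ᶜ ∧
            (2 ≤ (a x.1 x.2).1 → (↑(iterBlock (lv K (a x.1 x.2).1) (a x.1 x.2).2) : Set (Site (F.P (K₀ + K)) 0)) ⊆
              (truncShift F θ.ν hM (histB₁₃ θ K₀ g₀ K) s').Λ ((a x.1 x.2).1 - 1))),
        classWeightOfDatum₉ F N θ.toStage9Params (datumOfRecord₁₃CoPH F N θ hP) g₀ os (runB₁₃ F K₀ g₀ K) (histB₁₃ θ K₀ g₀ K) (K₀ + K + 1) t s' ≤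
      (∏ x ∈ p.2.attach, ζ K j (a x.1 x.2).1) * ∑ s' : SeqOfRecord F θ.ν θ.τ9.M (histB₁₃ θ K₀ g₀ K) (K₀ + K + 1) (K₀ + K + 1),
        classWeightOfDatum₉ F N θ.toStage9Params (datumOfRecord₁₃CoPH F N θ hP) g₀ os (runB₁₃ F K₀ g₀ K) (histB₁₃ θ K₀ g₀ K) (K₀ + K + 1) t s') :
    RelWeightBound 1 (classSetK₁₃ θ K₀ g₀ (keyReadingId₁₃ N K₀ F θ hP g₀ os)) (weightAK₁₃ θ hP K₀ g₀ os (keyReadingId₁₃ N K₀ F θ hP g₀ os))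
      (weightBK₁₃ θ hP K₀ g₀ os (keyReadingId₁₃ N K₀ F θ hP g₀ os))
      (badClassK₁₃ θ K₀ g₀ (keyReadingId₁₃ N K₀ F θ hP g₀ os)
        (badKeyReadingOfBigComponent₁₃ N K₀ jcut (bigDialOfCard₁₃ K₀ (fun K j => (2 * ϱ K j + 1) ^ 4 * k K j * (F.L ^ 4) ^ lv K j)) F θ hP g₀ os))
      (fun K => η₀ * (1 / 2) ^ (K + 1)) := by
  refine relWeightBound_card_of_sepInsideSeqLetters_id_supNear θ hP K₀ g₀ os jcut ϱ k lv hM hη0 hη1 hη₀ hD hks hlv hlvj ?_ ?_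
  · intro K t ht j hj p hp
    obtain ⟨h1, hjc⟩ := Finset.mem_Icc.1 hj
    have hmono' : ∀ i i', 1 ≤ i → i ≤ i' → i' ≤ j → lv K i ≤ lv K i' := fun i i' hi hii' hi'j => hmono K i i' hi hii' (hi'j.trans hjc)
    have hlvle : ∀ i, 1 ≤ i → i ≤ j → lv K i ≤ i := fun i hi hij => hlvj K i (Finset.mem_Icc.2 ⟨hi, hij.trans hjc⟩)
    have htot : 0 ≤ ∑ s : SeqOfRecord F θ.ν θ.τ9.M (histA₁₃ θ K₀ g₀ K) (K₀ + K) (K₀ + K),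
        classWeightOfDatum₉ F N θ.toStage9Params (datumOfRecord₁₃CoPH F N θ hP) g₀ os (runA₁₃ F K₀ g₀ K) (histA₁₃ θ K₀ g₀ K) (K₀ + K) t s :=
      Finset.sum_nonneg fun s _ => classWeightOfDatum₉_nonneg' F N θ.toStage9Params (datumOfRecord₁₃CoPH F N θ hP) g₀ os (runA₁₃ F K₀ g₀ K)
        (histA₁₃ θ K₀ g₀ K) (K₀ + K) (wOfRecord₉_nonneg_of_provisos₁₃CoPH F θ hP (runA₁₃ F K₀ g₀ K) (histA₁₃ θ K₀ g₀ K)) t s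
    have hcard : p.2.card = k K j := (card_eq_of_mem_sepAnimalCoverFamily _ _ hp).1
    refine (sum_insideFamily_le_sum_jointFresh_A θ hP K₀ g₀ os lv K t h1 hmono' (hlv K) hlvle p.2).trans ?_
    refine (Finset.sum_le_sum fun a ha => hPA K t ht j hj p hp a ha).trans ?_
    rw [← Finset.sum_mul, sum_pi_prod_eq_prod_volume K₀ lv K hmono' (hlv K j) ζ p.2, ← hcard]
    exact mul_le_mul_of_nonneg_right (prod_volume_le_pow K₀ lv (hζ0 K j) (hζη K j hj) p.2) htot
  · intro K t ht j hj p hp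
    obtain ⟨h1, hjc⟩ := Finset.mem_Icc.1 hj
    have hmono' : ∀ i i', 1 ≤ i → i ≤ i' → i' ≤ j → lv K i ≤ lv K i' := fun i i' hi hii' hi'j => hmono K i i' hi hii' (hi'j.trans hjc)
    have hlvle : ∀ i, 1 ≤ i → i ≤ j → lv K i ≤ i := fun i hi hij => hlvj K i (Finset.mem_Icc.2 ⟨hi, hij.trans hjc⟩)
    have htot : 0 ≤ ∑ s' : SeqOfRecord F θ.ν θ.τ9.M (histB₁₃ θ K₀ g₀ K) (K₀ + K + 1) (K₀ + K + 1),
        classWeightOfDatum₉ F N θ.toStage9Params (datumOfRecord₁₃CoPH F N θ hP) g₀ os (runB₁₃ F K₀ g₀ K) (histB₁₃ θ K₀ g₀ K) (K₀ + K + 1) t s' :=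
      Finset.sum_nonneg fun s' _ => classWeightOfDatum₉_nonneg' F N θ.toStage9Params (datumOfRecord₁₃CoPH F N θ hP) g₀ os (runB₁₃ F K₀ g₀ K)
        (histB₁₃ θ K₀ g₀ K) (K₀ + K + 1) (wOfRecord₉_nonneg_of_provisos₁₃CoPH F θ hP (runB₁₃ F K₀ g₀ K) (histB₁₃ θ K₀ g₀ K)) t s'
    have hcard : p.2.card = k K j := (card_eq_of_mem_sepAnimalCoverFamily _ _ hp).1
    refine (sum_insideFamily_le_sum_jointFresh_B θ hP K₀ g₀ os lv hM K t h1 hmono' (hlv K) hlvle p.2).trans ?_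
    refine (Finset.sum_le_sum fun a ha => hPB K t ht j hj p hp a ha).trans ?_
    rw [← Finset.sum_mul, sum_pi_prod_eq_prod_volume K₀ lv K hmono' (hlv K j) ζ p.2, ← hcard]
    exact mul_le_mul_of_nonneg_right (prod_volume_le_pow K₀ lv (hζ0 K j) (hζη K j hj) p.2) htot

end Face

end YMDAG.UVSplit

end
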